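import Literature.NumberTheory.LFunctions.DirichletLFunctionBounds
import Literature.NumberTheory.LFunctions.ZetaLogDerivRealBound
import Literature.NumberTheory.LFunctions.VinogradovKorobovInputsProofs
import Literature.Analysis.SpecialFunctions.EulerMascheroniBounds
import HarnessLib

/-!
# Khale 2024, Lemma 4.1: elementary explicit bounds for `L(s, χ)` and `L'/L(s, χ)` on `σ > 1`

Topic `Literature/NumberTheory/LFunctions`.  Everything in this file is PROVED; no definition, no
named fact.  **Lemma 4.1 of T. Khale, *An explicit Vinogradov–Korobov zero-free region for Dirichlet
L-functions*, Q. J. Math. 75 (2024) = arXiv:2210.06457v1 (p. 6)** — the first of the "basic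
estimates" of §4 there, on which the bootstrapping Theorem 3.1 (the analytic core of the named fact
`Literature.NumberTheory.LFunctions.Khale2024_zeroFreeRegion`, see `VinogradovKorobovDirichletProofs.lean`)
is built:

> If `1 < σ ≤ 1.06` and `t` is real, then for any Dirichlet character `χ` (mod `q`),
> `1/ζ(σ) ≤ |L(σ + it, χ)| ≤ ζ(σ) ≤ 0.6 + 1/(σ − 1)`.  For all `σ > 1` and real `t`,
> `|−L'/L(σ + it, χ)| < 1/(σ − 1)`.

("This follows immediately from [Ford, *Zero-free regions for the Riemann zeta function*,
Lemma 3.1]" — the `ζ` statement, whose last inequality is the tree's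
`neg_logDeriv_riemannZeta_ofReal_lt` / `norm_LSeries_vonMangoldt_lt`, `ZetaLogDerivRealBound.lean`.)
For every modulus `q ≥ 1`, every character (principal and imprimitive included) and `σ = Re s > 1`:

* `KhaleL41.norm_LSeries_le_re_riemannZeta` — `‖L(f, s)‖ ≤ ζ(σ)` for coefficients `‖f(n)‖ ≤ 1`
  (the termwise comparison behind the tree's `ZetaClassicalRegion.norm_LSeries_le_of_norm_le_one`,
  stopped at `ζ(σ)` instead of `σ/(σ−1)`);
* `KhaleL41.norm_LFunction_le_re_riemannZeta` — **`|L(s, χ)| ≤ ζ(σ)`**;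
* `KhaleL41.inv_re_riemannZeta_le_norm_LFunction` — **`1/ζ(σ) ≤ |L(s, χ)|`** (`1/L(s, χ) = L(χμ, s)`,
  Mathlib's `DirichletCharacter.LSeries.mul_mu_eq_one`, and `|χ(n)μ(n)| ≤ 1`);
* `KhaleL41.re_riemannZeta_le_point_six_add` — **`ζ(σ) ≤ 0.6 + 1/(σ − 1)` for `1 < σ ≤ 1.06`**, from
  Ramaré's bound `ζ(σ) ≤ e^{γ(σ−1)}/(σ−1)` (`zeta_real_le_ramare_holds`) and
  `e^{γδ} ≤ 1 + γδ + γ²δ² ≤ 1 + 0.6 δ` for `0 < δ ≤ 0.06` (`γ < 0.57721571`);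
* `KhaleL41.norm_logDeriv_LFunction_lt` — **`|L'/L(s, χ)| < 1/(σ − 1)`** (`|∑ χ(n)Λ(n)n^{−s}| ≤
  ∑ Λ(n) n^{−σ} = −ζ'/ζ(σ) < 1/(σ−1)`), the explicit form of the tree's `DirichletZFR.exists_norm_logDeriv_le`
  (which has `1/(σ−1) + K₀` with an unspecified `K₀`).

## References

* T. Khale, arXiv:2210.06457v1, Lemma 4.1 (p. 6). [Khale2024]
* K. Ford, *Zero-free regions for the Riemann zeta function*, Number Theory for the Millennium II
  (2002), 25–56 = arXiv:1910.08205, Lemma 3.1. [Ford2002Millennium]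
-/

noncomputable section

open Complex Filter Topology Set
open scoped LSeries.notation ArithmeticFunction.vonMangoldt ArithmeticFunction.Moebius

namespace Literature.NumberTheory.LFunctions

namespace KhaleL41

/-! ### `|L(s, χ)| ≤ ζ(σ)` and `1/ζ(σ) ≤ |L(s, χ)|` -/

/-- `‖L(f, s)‖ ≤ ζ(σ)` for coefficients `‖f(n)‖ ≤ 1` and `σ = Re s > 1` (termwise comparison with
`ζ(σ) = ∑ n^{−σ}`). [cite: Ford2002Millennium, Lemma 3.1] -/
theorem norm_LSeries_le_re_riemannZeta {f : ℕ → ℂ} (hf : ∀ n, ‖f n‖ ≤ 1) {s : ℂ}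
    (hs : 1 < s.re) : ‖LSeries f s‖ ≤ (riemannZeta s.re).re := by
  set σ : ℝ := s.re with hσdef
  have hsum1 : LSeriesSummable 1 (σ : ℂ) := LSeriesSummable_one_iff.2 (by simp [hs])
  have hterm : ∀ n, ‖LSeries.term f s n‖ ≤ ‖LSeries.term 1 (σ : ℂ) n‖ := by
    intro n
    rcases eq_or_ne n 0 with rfl | hn
    · simp
    rw [LSeries.norm_term_eq, LSeries.norm_term_eq, if_neg hn, if_neg hn]
    simp only [Pi.one_apply, norm_one, Complex.ofReal_re]
    exact div_le_div_of_nonneg_right (hf n) (by positivity)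
  have hsumf : Summable fun n => ‖LSeries.term f s n‖ :=
    Summable.of_nonneg_of_le (fun n => norm_nonneg _) hterm hsum1.norm
  have h2 : ∀ n, ‖LSeries.term 1 (σ : ℂ) n‖ = (LSeries.term 1 (σ : ℂ) n).re := by
    intro n
    rcases eq_or_ne n 0 with rfl | hn
    · simp
    rw [LSeries.norm_term_eq, if_neg hn, LSeries.term_of_ne_zero hn]
    simp only [Pi.one_apply, norm_one, Complex.ofReal_re]
    have : (n : ℂ) ^ (σ : ℂ) = ((n : ℝ) ^ σ : ℝ) := by
      rw [Complex.ofReal_cpow (Nat.cast_nonneg n)]; simp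
    rw [this, show (1 : ℂ) = ((1 : ℝ) : ℂ) from rfl, ← Complex.ofReal_div, Complex.ofReal_re]
  have h3 : (LSeries 1 (σ : ℂ)).re = ∑' n, (LSeries.term 1 (σ : ℂ) n).re := by
    rw [LSeries, Complex.re_tsum hsum1]
  calc ‖LSeries f s‖ ≤ ∑' n, ‖LSeries.term f s n‖ := norm_tsum_le_tsum_norm hsumf
    _ ≤ ∑' n, ‖LSeries.term 1 (σ : ℂ) n‖ := Summable.tsum_le_tsum hterm hsumf hsum1.norm
    _ = ∑' n, (LSeries.term 1 (σ : ℂ) n).re := tsum_congr h2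
    _ = (LSeries 1 (σ : ℂ)).re := h3.symm
    _ = (riemannZeta σ).re := by rw [LSeries_one_eq_riemannZeta (by simp [hs])]

variable {q : ℕ} [NeZero q] (χ : DirichletCharacter ℂ q)

/-- **`|L(σ + it, χ)| ≤ ζ(σ)`** for `σ > 1` and every Dirichlet character `χ`.
[cite: Khale2024, Lemma 4.1] -/
theorem norm_LFunction_le_re_riemannZeta {s : ℂ} (hs : 1 < s.re) :
    ‖χ.LFunction s‖ ≤ (riemannZeta s.re).re := by
  rw [DirichletCharacter.LFunction_eq_LSeries χ hs]
  exact norm_LSeries_le_re_riemannZeta (fun n ↦ DirichletCharacter.norm_le_one χ _) hs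

/-- **`1/ζ(σ) ≤ |L(σ + it, χ)|`** for `σ > 1` and every Dirichlet character `χ`: `L(s, χ) · L(χμ, s) = 1`
and `|L(χμ, s)| ≤ ζ(σ)`. [cite: Khale2024, Lemma 4.1] -/
theorem inv_re_riemannZeta_le_norm_LFunction {s : ℂ} (hs : 1 < s.re) :
    ((riemannZeta s.re).re)⁻¹ ≤ ‖χ.LFunction s‖ := by
  have hmul := DirichletCharacter.LSeries.mul_mu_eq_one χ hs
  rw [← DirichletCharacter.LFunction_eq_LSeries χ hs] at hmul
  have hnorm : ‖χ.LFunction s‖ * ‖L (↗χ * ↗μ) s‖ = 1 := by rw [← norm_mul, hmul, norm_one]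
  have hμ : ‖L (↗χ * ↗μ) s‖ ≤ (riemannZeta s.re).re := by
    refine norm_LSeries_le_re_riemannZeta (fun n ↦ ?_) hs
    rw [Pi.mul_apply, norm_mul]
    have h1 : ‖(↗χ : ℕ → ℂ) n‖ ≤ 1 := DirichletCharacter.norm_le_one χ _
    have h2 : ‖(↗μ : ℕ → ℂ) n‖ ≤ 1 := by
      rw [show (↗μ : ℕ → ℂ) n = ((μ n : ℤ) : ℂ) from rfl, Complex.norm_intCast]
      exact_mod_cast ArithmeticFunction.abs_moebius_le_one
    calc ‖(↗χ : ℕ → ℂ) n‖ * ‖(↗μ : ℕ → ℂ) n‖ ≤ 1 * 1 :=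
          mul_le_mul h1 h2 (norm_nonneg _) zero_le_one
      _ = 1 := one_mul _
  have hpos : 0 < ‖L (↗χ * ↗μ) s‖ := by
    rcases (norm_nonneg (L (↗χ * ↗μ) s)).eq_or_lt with h | h
    · rw [← h, mul_zero] at hnorm; exact absurd hnorm zero_ne_one
    · exact h
  have hinv : ‖χ.LFunction s‖ = (‖L (↗χ * ↗μ) s‖)⁻¹ := eq_inv_of_mul_eq_one_left hnorm
  rw [hinv]
  exact inv_anti₀ hpos hμ

/-! ### `ζ(σ) ≤ 0.6 + 1/(σ − 1)` on `1 < σ ≤ 1.06` -/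

/-- **`ζ(σ) ≤ 0.6 + 1/(σ − 1)` for `1 < σ ≤ 1.06`**, from Ramaré's bound
`ζ(σ) ≤ e^{γ(σ−1)}/(σ − 1)` (the tree's `zeta_real_le_ramare_holds`) and
`e^{γδ} ≤ 1 + γδ + (γδ)² ≤ 1 + 0.6 δ` for `0 < δ ≤ 0.06`, `γ < 0.57721571`.
[cite: Khale2024, Lemma 4.1] [cite: Ford2002Millennium, Lemma 3.1] -/
theorem re_riemannZeta_le_point_six_add {σ : ℝ} (hσ : 1 < σ) (hσ' : σ ≤ 1.06) :
    (riemannZeta σ).re ≤ 0.6 + 1 / (σ - 1) := by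
  have hR := zeta_real_le_ramare_holds σ hσ
  set η : ℝ := σ - 1 with hηdef
  have hη0 : 0 < η := by rw [hηdef]; linarith
  have hη1 : η ≤ 0.06 := by rw [hηdef]; linarith
  set γ : ℝ := Real.eulerMascheroniConstant
  have hγ0 : 0 < γ := lt_trans (by norm_num) Real.one_half_lt_eulerMascheroniConstant
  have hγ1 : γ < 0.57721571 := Literature.Analysis.SpecialFunctions.Real.eulerMascheroniConstant_lt_d8
  have hx0 : 0 ≤ γ * η := by positivity
  have hx1 : γ * η ≤ 1 := by nlinarith
  have hexp : Real.exp (γ * η) ≤ 1 + γ * η + (γ * η) ^ 2 := by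
    have h := Real.abs_exp_sub_one_sub_id_le (show |γ * η| ≤ 1 by rwa [abs_of_nonneg hx0])
    have := (abs_le.1 h).2
    linarith
  have hquad : 1 + γ * η + (γ * η) ^ 2 ≤ 1 + 0.6 * η := by nlinarith
  have hkey : Real.exp (γ * η) / η ≤ 0.6 + 1 / η := by
    rw [div_le_iff₀ hη0, add_mul, one_div_mul_cancel hη0.ne']
    linarith
  exact hR.trans hkey

/-- The two-sided form of the first display of Lemma 4.1: for `1 < σ ≤ 1.06`, `σ = Re s`,
`1/ζ(σ) ≤ |L(s, χ)| ≤ ζ(σ) ≤ 0.6 + 1/(σ − 1)`. [cite: Khale2024, Lemma 4.1] -/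
theorem lemma41_first {s : ℂ} (hs : 1 < s.re) (hs' : s.re ≤ 1.06) :
    ((riemannZeta s.re).re)⁻¹ ≤ ‖χ.LFunction s‖ ∧ ‖χ.LFunction s‖ ≤ (riemannZeta s.re).re ∧
      (riemannZeta s.re).re ≤ 0.6 + 1 / (s.re - 1) :=
  ⟨inv_re_riemannZeta_le_norm_LFunction χ hs, norm_LFunction_le_re_riemannZeta χ hs,
    re_riemannZeta_le_point_six_add hs hs'⟩

/-! ### `|L'/L(s, χ)| < 1/(σ − 1)` -/

/-- **`|−L'/L(σ + it, χ)| < 1/(σ − 1)`** for `σ > 1` and every Dirichlet character `χ`: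
`|∑ χ(n)Λ(n) n^{−s}| ≤ ∑ Λ(n) n^{−σ} = −ζ'/ζ(σ) < 1/(σ − 1)` (Ford's Lemma 3.1 for the last step).
[cite: Khale2024, Lemma 4.1] [cite: Ford2002Millennium, Lemma 3.1] -/
theorem norm_logDeriv_LFunction_lt {s : ℂ} (hs : 1 < s.re) :
    ‖deriv χ.LFunction s / χ.LFunction s‖ < 1 / (s.re - 1) := by
  rw [← norm_neg, DirichletZFR.neg_logDeriv_LFunction_eq χ hs]
  obtain ⟨-, hle⟩ := DirichletZFR.norm_LSeries_twist_le χ hs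
  have hσ : 1 < ((s.re : ℝ) : ℂ).re := by simp [hs]
  have hreal := DirichletZFR.LSeries_vonMangoldt_ofReal hs
  have hlt := norm_LSeries_vonMangoldt_lt hσ
  rw [Complex.ofReal_re] at hlt
  have hsum_le : ∑' n : ℕ, Λ n / (n : ℝ) ^ s.re ≤ ‖L ↗Λ (s.re : ℂ)‖ := by
    rw [hreal, Complex.norm_real, Real.norm_eq_abs]
    exact le_abs_self _
  exact (hle.trans hsum_le).trans_lt hlt

/-- The same for `−L'/L`. [cite: Khale2024, Lemma 4.1] -/
theorem norm_neg_logDeriv_LFunction_lt {s : ℂ} (hs : 1 < s.re) :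
    ‖-(deriv χ.LFunction s / χ.LFunction s)‖ < 1 / (s.re - 1) := by
  rw [norm_neg]; exact norm_logDeriv_LFunction_lt χ hs

end KhaleL41

end Literature.NumberTheory.LFunctions
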